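import Literature.MathematicalPhysics.KineticTheory.HardSphereEuler
import Literature.Analysis.FluidPDE.LocalForecastCorrector
import HarnessLib

/-!
# Collar locality: forecast data are good almost everywhere

Companion of `AntiMazurCoboundariesKineticWindowGronwallCollarLocality` (crux `KineticWindowGronwall`,
stmt-AtomisticToContinuum-9282, line `dlr-block-transfer`, registered stub
`stub_collarLocality : CollarInfluenceLocality`), registered helper stub
`stub_forecastDataGood : ForecastDataGoodAE` — **forecast data are good a.e.** (the junk audit of the stub,
settled): for any law absolutely continuous with respect to the Liouville measure — in particular every
`localGibbsLaw` (`localGibbsLaw_absolutelyContinuous`: `particleLaw` is `liouville.withDensity`) — almost every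
datum is good for the true flow `Φ` AND every one of its range clusters (any range) restricts to a good datum of
the cluster flow of its size (`ae_good_and_rangeCluster_good`). Ingredients: `volume_preimage_restrictTo_eq_zero`
— the coordinate projection `Config.restrictTo S` pulls Lebesgue-null sets back to Lebesgue-null sets (up to the
measure-preserving equivalences `MeasurableEquiv.piEquivPiSubtypeProd`, `MeasurableEquiv.piCongrLeft` it is the
first projection of a product); a sub-configuration of a non-overlapping configuration is non-overlapping; the
Liouville-null set `(Ψ k).goodᶜ ∩ D_ε` (`HardSphereFlow.measure_compl_good`); union over the finitely many `S`.
Hence, whatever the family `Ψ` of cluster flows, off a null set the integrand of `CollarInfluenceLocality`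
compares two genuine hard-sphere trajectories (`clusterStateIn_of_mem_good`, `HardSphereFlow.isTrajectory`):
an adversarial `Ψ` cannot corrupt forecasts through the junk values off its good sets.

References: R. K. Alexander, *The infinite hard sphere system* (1975), Ch. 2; I. Gallagher, L. Saint-Raymond,
B. Texier, *From Newton to Boltzmann* (2013), Prop. 4.1.1.
-/
noncomputable section

namespace Summit.AtomisticToContinuum.HydrodynamicLimit.Theorems.KineticWindowGronwallCollarLocality

open MeasureTheory Set Filter Topology
open scoped ENNReal BigOperators
open Literature.MathematicalPhysics.KineticTheory (T3 V3 hsDiameter localGibbsLaw)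
open Literature.Analysis.FluidPDE

/-! ## Null sets: forecast data are good almost everywhere -/

section NullSets

/-- Reindexing-and-projecting a product measure: the preimage of a null measurable set of `Fin S.card → Y`
under `z ↦ z ∘ S.orderEmbOfFin` is null in `Fin n → Y` (σ-finite factor `μ`; the map is, up to the
measure-preserving equivalences `MeasurableEquiv.piEquivPiSubtypeProd` and `MeasurableEquiv.piCongrLeft`,
the first projection of a product, and `(μ_S × μ_{Sᶜ})(B × univ) = μ_S(B) · μ_{Sᶜ}(univ) = 0`). -/
theorem pi_preimage_comp_orderEmbOfFin_eq_zero {Y : Type*} [MeasurableSpace Y] (μ : Measure Y)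
    [SigmaFinite μ] {n : ℕ} (S : Finset (Fin n)) {B : Set (Fin S.card → Y)} (hBm : MeasurableSet B)
    (hB : Measure.pi (fun _ : Fin S.card => μ) B = 0) :
    Measure.pi (fun _ : Fin n => μ) {z | (fun m => z (S.orderEmbOfFin rfl m)) ∈ B} = 0 := by
  classical
  set φ : Fin S.card ≃ {j // j ∈ S} := (S.orderIsoOfFin rfl).toEquiv with hφ
  set g : ({j // j ∈ S} → Y) → (Fin S.card → Y) := fun w m => w (φ m) with hg
  set e := MeasurableEquiv.piCongrLeft (fun _ : {j // j ∈ S} => Y) φ with he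
  have heg : ∀ w, e.symm w = g w := by
    intro w
    funext m
    have h1 : e (e.symm w) (φ m) = (e.symm w) m := by
      rw [he, MeasurableEquiv.coe_piCongrLeft, Equiv.piCongrLeft_apply_apply]
    rw [← h1, e.apply_symm_apply]
  have hgmp : MeasurePreserving g (Measure.pi fun _ : {j // j ∈ S} => μ)
      (Measure.pi fun _ : Fin S.card => μ) := by
    have h := (measurePreserving_piCongrLeft (fun _ : {j // j ∈ S} => μ) φ).symm e
    refine ⟨?_, ?_⟩
    · have : g = fun w => e.symm w := funext fun w => (heg w).symm
      rw [this]; exact h.measurable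
    · have : (fun w => e.symm w) = g := funext heg
      rw [← this]; exact h.map_eq
  have hE := measurePreserving_piEquivPiSubtypeProd (fun _ : Fin n => μ) (· ∈ S)
  have hset : {z : Fin n → Y | (fun m => z (S.orderEmbOfFin rfl m)) ∈ B} =
      (MeasurableEquiv.piEquivPiSubtypeProd (fun _ => Y) (· ∈ S)) ⁻¹' ((g ⁻¹' B) ×ˢ Set.univ) := by
    ext z
    simp only [mem_setOf_eq, mem_preimage, mem_prod, mem_univ, and_true, hg, hφ]
    rfl
  have h0 : (Measure.pi fun _ : {j // j ∈ S} => μ) (g ⁻¹' B) = 0 := by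
    rw [hgmp.measure_preimage hBm.nullMeasurableSet, hB]
  rw [hset, hE.measure_preimage ((hgmp.measurable hBm).prod MeasurableSet.univ).nullMeasurableSet,
    Measure.prod_prod]
  refine mul_eq_zero_of_left ?_ _
  convert h0 using 2
  exact congrArg (fun inst : Fintype {j // j ∈ S} => @Measure.pi {j // j ∈ S} (fun _ => Y) inst
    (fun _ => inferInstance) fun _ => μ) (Subsingleton.elim _ _)

variable {d : Type*} [Fintype d] {X : Type*} [MeasureSpace X]

/-- The preimage of a Lebesgue-null measurable set of `S.card`-particle configurations under the restriction
`Config.restrictTo S` is Lebesgue-null. -/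
theorem volume_preimage_restrictTo_eq_zero [SigmaFinite (volume : Measure X)] {n : ℕ}
    (S : Finset (Fin n)) {B : Set (Config S.card d X)} (hBm : MeasurableSet B) (hB : volume B = 0) :
    volume (Config.restrictTo S ⁻¹' B) = 0 := by
  rw [volume_pi] at hB ⊢
  exact pi_preimage_comp_orderEmbOfFin_eq_zero volume S hBm hB

variable [TopologicalSpace X] {G : Geometry d X} {ε : ℝ}

/-- Liouville-almost every `n`-particle configuration restricts, on any set `S` of particles, to a GOOD datum
of any hard-sphere flow of `S.card` spheres of the same diameter (a sub-configuration of a non-overlapping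
configuration is non-overlapping, and the Liouville-null set `goodᶜ ∩ D_ε` pulls back to a Lebesgue-null set). -/
theorem ae_liouville_restrictTo_mem_good [SigmaFinite (volume : Measure X)]
    (hGm : Measurable fun p : X × X => G.sepVec p.1 p.2) {n : ℕ} (S : Finset (Fin n))
    (Ψ : HardSphereFlow G ε S.card) : ∀ᵐ z ∂(liouville G n ε), Config.restrictTo S z ∈ Ψ.good := by
  rw [ae_iff, liouville_eq, Measure.restrict_apply_eq_zero' (measurableSet_hardSphereDomain G hGm n ε)]
  refine measure_mono_null (t := Config.restrictTo S ⁻¹' (Ψ.goodᶜ ∩ hardSphereDomain G S.card ε)) ?_ ?_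
  · rintro z ⟨hz, hzD⟩
    exact ⟨hz, fun a b hab => hzD _ _ fun h => hab ((S.orderEmbOfFin rfl).injective h)⟩
  · refine volume_preimage_restrictTo_eq_zero S
      (Ψ.measurableSet_good.compl.inter (measurableSet_hardSphereDomain G hGm _ ε)) ?_
    have h := Ψ.measure_compl_good
    rwa [liouville_eq, Measure.restrict_apply Ψ.measurableSet_good.compl] at h

/-- **Forecast data are good almost everywhere.** For any law absolutely continuous with respect to the
Liouville measure, almost every datum is good for the flow `Φ` AND every one of its range clusters (any range
`R`) restricts to a good datum of the cluster flow of its size — so that along `Φ` and along every forecast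
`localClusterState Ψ R · z i` one follows genuine hard-sphere trajectories (`clusterStateIn_of_mem_good`). -/
theorem ae_good_and_rangeCluster_good [SigmaFinite (volume : Measure X)]
    (hGm : Measurable fun p : X × X => G.sepVec p.1 p.2) {n : ℕ} (Φ : HardSphereFlow G ε n)
    (Ψ : (k : ℕ) → HardSphereFlow G ε k) {μ : Measure (Config n d X)} (hμ : μ ≪ liouville G n ε)
    (R : ℝ) :
    ∀ᵐ z ∂μ, z ∈ Φ.good ∧
      ∀ i, Config.restrictTo (rangeCluster G R z i) z ∈ (Ψ (rangeCluster G R z i).card).good := by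
  have h2 : ∀ᵐ z ∂(liouville G n ε), ∀ S : Finset (Fin n), Config.restrictTo S z ∈ (Ψ S.card).good :=
    ae_all_iff.2 fun S => ae_liouville_restrictTo_mem_good hGm S (Ψ S.card)
  refine hμ.ae_le ?_
  filter_upwards [Φ.ae_mem_good, h2] with z hz hS
  exact ⟨hz, fun i => hS _⟩

/-- Local Gibbs laws (any profiles) are absolutely continuous with respect to the Liouville measure
(`particleLaw` is `liouville.withDensity`). -/
theorem localGibbsLaw_absolutelyContinuous (σ : ℝ) (a₀ θ₀ : T3 → ℝ) (u₀ : T3 → V3) (N : ℕ)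
    (Φ : HardSphereFlow (Torus.geometry (Fin 3)) (hsDiameter σ N) (N + 1)) :
    localGibbsLaw σ a₀ u₀ θ₀ N Φ ≪ liouville (Torus.geometry (Fin 3)) (N + 1) (hsDiameter σ N) := by
  unfold localGibbsLaw
  rw [particleLaw_eq]
  exact withDensity_absolutelyContinuous _ _

end NullSets

/-! ## The registered statement (torus, the objects of `CollarInfluenceLocality`) -/

/-- **FORECAST DATA ARE GOOD `G`-ALMOST EVERYWHERE** (registered helper stub `stub_forecastDataGood` of line
`dlr-block-transfer`, crux `KineticWindowGronwall`, stmt-AtomisticToContinuum-9282): under every local Gibbs law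
of `N + 1` spheres of diameter `hsDiameter σ N` on `𝕋³` (any profiles, any `σ`), almost every datum is good for
the true flow `Φ` and, for every particle `i` and range `r`, the range-`r` cluster of `i` restricts to a good
datum of the cluster flow `Ψ k` of its size: off a `G`-null set the integrand of `CollarInfluenceLocality`
compares two genuine hard-sphere trajectories (no junk values of `Φ.flow` or of `localClusterState` are met),
whatever the family `Ψ`. This settles the junk audit of the stub: an adversarial `Ψ` cannot corrupt forecasts
through its good set. -/
def ForecastDataGoodAE : Prop :=
  ∀ (σ : ℝ) (a₀ θ₀ : T3 → ℝ) (u₀ : T3 → V3) (N : ℕ)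
    (Φ : HardSphereFlow (Torus.geometry (Fin 3)) (hsDiameter σ N) (N + 1))
    (Ψ : (k : ℕ) → HardSphereFlow (Torus.geometry (Fin 3)) (hsDiameter σ N) k) (r : ℝ),
    ∀ᵐ z ∂(localGibbsLaw σ a₀ u₀ θ₀ N Φ), z ∈ Φ.good ∧
      ∀ i : Fin (N + 1), Config.restrictTo (rangeCluster (Torus.geometry (Fin 3)) r z i) z ∈
        (Ψ (rangeCluster (Torus.geometry (Fin 3)) r z i).card).good

/-- **STUB `stub_forecastDataGood`** (helper stub of line `dlr-block-transfer`, crux `KineticWindowGronwall`,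
stmt-AtomisticToContinuum-9282): forecast data are good almost everywhere under local Gibbs laws on `𝕋³`
(`ae_good_and_rangeCluster_good`, `localGibbsLaw_absolutelyContinuous`, `Torus.measurable_geometry_sepVec`). -/
theorem stub_forecastDataGood : ForecastDataGoodAE :=
  fun σ a₀ θ₀ u₀ N Φ Ψ r =>
    ae_good_and_rangeCluster_good Torus.measurable_geometry_sepVec Φ Ψ
      (localGibbsLaw_absolutelyContinuous σ a₀ θ₀ u₀ N Φ) r



end Summit.AtomisticToContinuum.HydrodynamicLimit.Theorems.KineticWindowGronwallCollarLocality

end
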